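import Literature.NumberTheory.EllipticCurves.Kobayashi2003.EtaKatoColemanPoitouTateSequences
import Literature.NumberTheory.EllipticCurves.Kim2026.ShaLengthRankZeroLowerBound
import Literature.NumberTheory.EllipticCurves.KuriharaNumberInvariants
import Literature.NumberTheory.EllipticCurves.Isogeny
import HarnessLib

/-!
# Castella–Sano (arXiv:2601.14504, PREPRINT 2026), Thm. 1 (i) ⟹ (ii) for the ADDITIVE partner
# `W = V ⊗ η_{p*}` of a good supersingular `a_p = 0` curve `V`, read on the pinned objects of
# Kobayashi's `η`-package: KIM'S TAMAGAWA-DEFECT IDENTITY `∂^{(∞)}(δ̃(W)) = ord_p Tam_W` gives the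
# EISENSTEIN inclusion of Kato's main conjecture for `T_pW` over `ℚ_∞` — ONE explicitly labelled OPEN
# hypothesis (nothing asserted; NEVER a theorem)

Topic `NumberTheory/EllipticCurves`, sub-directory `CastellaSano2026` (namespace = path,
`Literature.NumberTheory.EllipticCurves.CastellaSano2026`). ONE `def … : Prop` and nothing else: no
definition with computational content, no instance, no notation, no `_holds`. HONEST FRAMING: an
UNREFEREED preprint enters the tree only as an explicitly labelled OPEN hypothesis
(`[claim: …, status: under-review]`), NEVER as a theorem and never as a named fact; nothing here is
asserted about any curve; nothing is booked; BSD is not proved by any of this. Third file of this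
directory: the siblings `KatoMainIdentityOfKimTamagawaDefectOPEN` / `KimTamagawaDefectOfKatoMainIdentityOPEN`
(cell `bsd-ssimc`, 2026-08-28) read the SAME Theorem 1 at the TRIVIAL character for a curve GOOD
supersingular at `p` on Kobayashi's `η = 1` package. THIS file reads its direction (i) ⟹ (ii) where the
preprint is strictly NEW relative to the journal literature — at a prime of BAD (additive) reduction
with `p ∣ Tam` allowed — for the additive twist `W = V ⊗ η_{p*}` of a good supersingular `a_p(V) = 0`
curve `V/ℚ`, `p ≥ 5`, on the pinned objects of Kobayashi's `η`-package
(`Kobayashi2003.EtaKatoColemanPoitouTateData`, `η = ω^{(p−1)/2}` THE quadratic character), i.e. on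
EXACTLY the frame of the published companion `Kim2026.thm111_etaEisensteinInclusion_of_kuriharaNumber_ne_zero`
(C.-H. Kim, Amer. J. Math. 148 (2026) Thm. 1.11 (1) ⟹ (3) at `η`; proposal p534181), with Kim's
certificate «a UNIT Kurihara number, `p ∤ Tam_W`» replaced by Castella–Sano's hypothesis (i) «Kim's
Tamagawa-defect identity `∂^{(∞)}(δ̃) = ord_p Tam_W`», `p ∣ Tam_W` ALLOWED. Written for the cell
`bsd-potss` (HOME `run/shared/lean/pub/bsd-potss/`; HUMAN RULING D-0036/D-0074: the programme assembles
BSD for analytic rank ≤ 1 STRICTLY from published theorems and TYPES the remainder), seat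
`bsd-potss-k8eta-c1` g13, K8 route `QuadraticBranchSignedControl`, crux item stmt-BirchSwinnertonDyer-19601
`PlusEtaLowerInclusion`, registered stub `stub_etaLower_tamagawaRows` of skeleton v5
(`Summits/BirchSwinnertonDyer/BirchSwinnertonDyer/Cruxes/PlusEtaLowerInclusion/Lines/birth.lean`: "(E⁺_η)
on the tower-onto pairs with `p ∣ ∏ c_ℓ(W)` … no finite certificate known"); consumer
`Summits/BirchSwinnertonDyer/BirchSwinnertonDyer/Theorems/QuadraticBranchSignedControlPlusEtaLowerInclusionCastellaSanoRoad.lean`.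

## Why this file (what it adds to the tree's Kim / Kobayashi / Castella–Sano stories)

On the K8 crux 19601 the tree holds (i) the KURIHARA ROAD — Kim's Thm. 1.11 (1) ⟹ (3) read at `η`
(`Kim2026.thm111_…`), which turns the crux, pair by pair on the partners `W` with `p ∤ ∏ c_ℓ(W)`, into
ONE unit Kurihara number — and (ii) on the partners with `p ∣ ∏ c_ℓ(W)` (the "Tamagawa rows") only
LEVEL-ZERO instruments: Kim's criterion is void there ("Kato's Kolyvagin system cannot be primitive when
`p` divides Tamagawa factors", Kim Remark 6.2), and no published theorem converts a Kurihara number of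
positive `p`-divisibility index into Kato's main conjecture. Castella–Sano's Theorem 1 (January 2026,
unrefereed) claims exactly that conversion — «`𝓜_∞(δ) = ord_p(Tam_E)` ⟺ the Iwasawa Main Conjecture
for `ℚ_∞/ℚ`» for `E/ℚ` non-CM, `p > 3`, `ρ̄` onto, Manin constant prime to `p`, ANY reduction type at
`p` — and says so: "for non-ordinary (and possibly bad reduction) primes `p`, Theorem 1 was independently
proved by C.-H. Kim assuming `p ∤ Tam_E` (see [kim]), but the case `ord_p(Tam_E) > 0` of Theorem 1 was
wide open" (§1.3.1). Read at `η` through the SAME flagged zeta-line identification as the companion,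
its direction (i) ⟹ (ii) makes the Tamagawa rows of crux 19601 conditional data of the same SHAPE as
the Tamagawa-free rows: Kim's Conjecture 1.10 for `(W, p)` (`∂^{(∞)}(δ̃) = ∑_ℓ ord_p c_ℓ`, the tree's
typed `@[conjecture]` `Summit.….X4.KimTamagawaDefectAt` / `X4.kim2026_conjecture_1_10`) in place of
Kurihara's conjecture mod `p` (its case `ord_p Tam = 0`).

## The printed statements (F. Castella, T. Sano, *On refined nonvanishing conjectures by Kurihara and
Kolyvagin*, arXiv:2601.14504 v1 (2026); held text `paper:arxiv-2601.14504`, page = file number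
`pNNNN.txt`; FRESHNESS 2026-08-28: arXiv only, no journal record, no DOI other than the arXiv one)

* §1 (p0003 L3): "Building on a new approach to the descent computations in [BCGS], in this paper we
  obtain an extension of the results in op. cit. allowing `E` to have any reduction type at `p` in the
  case of the refined Kurihara conjectures".
* §1.1.1 (p0003): "Let `E/ℚ` be an elliptic curve of conductor `N` without complex multiplication, and
  fix an odd prime `p` such that (sur) `ρ̄ : G_ℚ → Aut_{𝔽_p}(E[p])` is surjective. …
  `𝓛 := {ℓ : ℓ ≡ 1 (mod p), ℓ ∤ N, a_ℓ ≡ ℓ + 1 (mod p)}` … `𝒩` the collection of all squarefree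
  products of primes `ℓ ∈ 𝓛` … `I_ℓ := (ℓ − 1, a_ℓ − ℓ − 1)ℤ_p ∩ ℤ` … Let `f ∈ S₂(Γ₀(N))` be the newform
  attached to `E`. Let `Ω_E^+ = ∫_{E(ℝ)} ω_E` … Fix a modular parametrization `φ : X₀(N) → E` and let
  `c_φ ∈ ℤ` be the associated Manin constant … Assume that `p ∤ c_φ`. …
  `δ_n := ∑_{a=1,(a,n)=1}^n \overline{[a/n]} (∏_{ℓ∣n} log_{𝔽_ℓ}(a)) ∈ ℤ/I_n`, where
  `[a/n] = Re(2πi ∫_∞^{a/n} f(z)dz)/Ω_E^+ ∈ ℚ`".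
* §1.1.2–1.1.3 (p0003–p0004): "`Tam_E := ∏_{ℓ∣N} c_ℓ` … `𝓜(n) := max{𝓜 ≥ 0 : δ_n ∈ p^𝓜 ℤ/I_n}`
  (`∞` if `δ_n = 0`) … `𝓜_r := min{𝓜(n) : n ∈ 𝒩, ν(n) = r}` … `𝓜_r ≥ 𝓜_{r+2} ≥ 0` …
  `𝓜_∞(δ) := lim_{r→∞, (−1)^r = ε} 𝓜_r` … **Conjecture 2 (Refined Kurihara's conjecture).** Let `p > 3`
  be a prime such that (sur) and (manin) both hold. Then `𝓜_∞(δ) = ord_p(Tam_E)`." ("formulated in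
  [kim]" = C.-H. Kim, Amer. J. Math. 148 (2026), Conjecture 1.10: `∂^{(∞)}(δ̃) = ∑_{ℓ∣N} ord_p(c_ℓ)`.)
* §1.1.4 (p0004 L26–L44), VERBATIM: "**Theorem 1.** Let `p > 3` be a prime such that (sur) and (manin)
  both hold. Then the following are equivalent: (i) `𝓜_∞(δ) = ord_p(Tam_E)`, and hence Conjecture 2
  holds. (ii) The Iwasawa Main Conjecture (conj:IMC-det) for `ℚ_∞/ℚ` holds." and (p0004 L50): "The
  Iwasawa Main Conjecture (conj:IMC-det) for `ℚ_∞/ℚ` in the above results is a reformulation of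
  [kato-euler-systems] in terms of determinants of arithmetic complexes." — §2.2, Prop. 2.2.3 (p0009):
  "Conjecture (conj:IMC-det) holds if and only if `char_Λ(H¹(ℤ_S, 𝕋)/Λ·z_∞^{(S)}) = char_Λ(H²(ℤ_S, 𝕋))`
  as ideals in `Λ`" (`z_∞^{(S)} := 𝒫_N · z_∞`, the `S`-imprimitive Kato class; `𝕋 = T ⊗ Λ`,
  `Λ = ℤ_p⟦Gal(ℚ_∞/ℚ)⟧`). Proof of (i) ⟹ (ii): §2.4 (p0011 L1–L13).
* §1.3.1 (p0006 L22): "for non-ordinary (and possibly bad reduction) primes `p`, Theorem 1 was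
  independently proved by C.-H. Kim assuming `p ∤ Tam_E` (see [kim]), but the case `ord_p(Tam_E) > 0`
  of Theorem 1 was wide open".
* S. Kobayashi, Invent. Math. 152 (2003), §5 p. 10: "**Kato's main conjecture.**
  `Char(𝐇²(T)^η) = Char(𝐇¹(T)^η/Z(T)^η)`" (component by component in `η : Δ → ℤ_p^×`,
  `K_∞ = ℚ(μ_{p^∞})`), Thm. 5.2 and the proof of Thm. 7.4 (p. 13): the `η`-component of Kato's modules
  for `T_pV` IS Kato's theory of the twist `T_pW = T_pV ⊗ η` over `ℚ_∞` — the reading under which the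
  tree's `η`-package `Kobayashi2003.EtaKatoColemanPoitouTateData p K₀ η V f ϖ κ γ W I FB` is stated on
  the pinned `I : Kato2004.IwasawaH1Data W p κ γ` («`𝐇¹(T_pV)^η = H¹_Iw(ℚ, T_pW)`») and
  `FB : W.FineSelmerDualData κ γ` («`X⁰(V/K_∞)^η = Sel₀(ℚ_∞, W[p^∞])^∨`»), exactly as in the companion.

## The hypothesis below and its reading (weaker than print, never stronger; flags for the referee)

Frame = VERBATIM that of `Kim2026.thm111_etaEisensteinInclusion_of_kuriharaNumber_ne_zero`: `p` odd,
`K₀ = ℚ(μ_p)`, `η` THE quadratic character, `V/ℚ` globally minimal good at `p` with `a_p(V) = 0`, a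
newform `f` of `V`, period ratio `ϖ`, cyclotomic `κ` with generator `γ` matching the variable, a
GLOBALLY MINIMAL partner `W` with `C • W^{(p*)} = V` (instance binder `ContinuousSMul ℤ_[p] (T_pW)`,
discharged by `TateModule.continuousSMul_padicInt`). Castella–Sano's standing hypotheses for `E := W`
at `p`, typed as in the sibling facts: `5 ≤ p` («`p > 3`»); `¬ W.HasCM` («without complex
multiplication»; automatic under (sur) at an odd `p`, `WeierstrassCurve.not_hasSurjectiveModNGaloisRep_of_hasCM`,
but kept as printed); (sur) `W.HasSurjectiveModNGaloisRep p`; (manin) through a modular parametrisation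
datum `D : ModularParametrizationData W NW` with `¬ p ∣ D.maninConstant` AND the period transfer
`Ω(W) = u · Ω⁺_{D.f}`, `|u|_p = 1` (reading `KR-period`, as in every Kim-type fact of the tree: the
tree's Kurihara numbers `kuriharaNumber D.f (p^k) n ψ` are `Ω⁺_{D.f}`-normalised, the printed `δ_n` are
`Ω_E^+`-normalised; the two collections differ by the unit `ū`, and `p`-DIVISIBILITY is insensitive to a
unit). HYPOTHESIS (i) in the tree's vocabulary: `kuriharaPartialInfty W p D.f = ord_p(W.tamagawaProduct)`
(`Literature/…/KuriharaNumberInvariants`: Kim's `∂^{(∞)}(δ̃) = min_i ∂^{(i)}(δ̃)` over the CYCLIC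
Kolyvagin levels `n ∈ 𝒩₁` with `#W̃(𝔽_ℓ)[p] ≤ p` — reading `CS26-1-cyclic-levels`: the printed `𝓜_∞(δ)`
is the infimum of `𝓜(n)` over ALL `n ∈ 𝒩` (`𝓜_r` non-increasing along `r` of the parity of the root
number, `δ_n = 0` at the other parity), Kim's `∂^{(∞)}` the same infimum organised by `ν(n)`; both are
stated over the cyclic levels here, exactly as the accepted trivial-character sibling and the Summits
predicate `X4.KimTamagawaDefectAt W p D.f`, which this hypothesis unfolds to; `W.tamagawaProduct` = the
product of the local Tamagawa numbers over all finite places = `Tam_W`). CONCLUSION (ii), KATO'S MAIN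
CONJECTURE for `T_pW` over `ℚ_∞`, recorded — as in the companion — by its EISENSTEIN half only, read on
the `η`-package: for every pinned `I`, `FB` there is a package datum `d` (Kobayashi Thm. 5.2/6.2/6.3/7.3
i)/Cor. 7.2 at `η`, as the package fact `Kobayashi2003.thm52_62_63_73_etaKatoColemanPoitouTate` asserts)
with `Module.charIdeal Λ FB.X ≤ Module.charIdeal Λ (I.H ⧸ Λ∙d.z)` — `Char_Λ(X⁰) ⊆ Char_Λ(𝐇¹/Λz)`; the
`⊇` half under the onto tower is the package's own field `kato_integral` (Kato Thm. 12.5). READING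
FLAGS. `CS26-1-eta-zeta-line` (= the companion's `Kim26-111-eta-zeta-line`, the one genuine reading):
Castella–Sano's (ii) is about the line `Λ·z_∞^{(S)} ⊂ H¹(ℤ_S, 𝕋)` of the `S`-imprimitive Kato class of
`f_W` (Prop. 2.2.3; `S`-imprimitive ⟺ Kato's own formulation by their remark after Cor. 1; at the
ADDITIVE prime `p` of `W` the Euler factor `P_p(W, X) = 1`, so the factor `𝒫_p` of `𝒫_N` is `1` and
`z_∞^{(S)}` carries no correction at `p` — the `ℓ ∣ N`, `ℓ ≠ p` corrections are units of `Λ` away from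
their own characteristic ideals exactly as in the companion's reading); it is READ on the line `Λ·z` of
a package datum (the `η`-part of Kato's zeta element of `f_V`): two norm-compatible Kato classes of the
SAME representation `T_pW = T_pV(η)` along `ℚ_∞`, characterised by the same twisted `L`-values; the
identification of the two `Λ`-lines is NOT formalised (nor is either zeta element a tree object).
`CS26-1-additive-scope`: Thm. 1 is applied to `E := W` ADDITIVE at `p` (`W = V ⊗ η_{p*}`, Kodaira I₀*):
the theorem is stated for ANY reduction type (§1 p0003 L3, §1.3.1), and the standing setup of §2.1
("fix an odd prime `p` such that (sur) and (manin) both hold", p0007) carries no reduction hypothesis;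
referee flag: the proof of Cor. 2.3.2 (p0010 L47) writes "Since `p ∤ N`" when bounding
`Eul_N(α) ∈ ℤ_(p)` — at an additive `p` the Euler factor at `p` is `1` and the displayed bound holds
verbatim, so the slip is immaterial on this locus; recorded, not resolved. `CS26-1-cyclic-levels`,
`KR-period`, cyclicity flag: as above / as in the siblings. Everything recorded is implied by, never
stronger than, the preprint's Theorem 1 under these readings; the hypothesis is CONDITIONAL DATA for its
consumers (hypothesis position), asserts nothing, and — unlike the companion — is NOT silent on the
partners with `p ∣ ∏ c_ℓ(W)`: there it is the ONLY road in print or preprint from a finite-looking datum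
(one Kurihara number of `p`-divisibility index `≤ ord_p Tam_W` bounds `∂^{(∞)}` from above; the matching
lower bound `∂^{(∞)} ≥ ord_p Tam_W` is the Kato-integrality half of the same identity and is NOT a finite
certificate) to Kato's main conjecture for `f_W`.

What this hypothesis is NOT: not Conjecture 2 / Kim's Conjecture 1.10 (no claim that the identity holds
for any curve — that is the typed `@[conjecture]` `X4.KimTamagawaDefectAt` / `X4.kim2026_conjecture_1_10`
of `Summits/BirchSwinnertonDyer/Rank1Residual/X4/KimTamagawaDefect.lean`); not the converse (ii) ⟹ (i);
not Theorem 2 (the cases where (ii) is known: good ordinary, or supersingular with square-free `N` — none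
is an additive `p`); not a statement at `p = 3`; not Kobayashi's even main conjecture at `η` (derived
Summits-side from this hypothesis + the package by the four-term-sequence algebra of the proof of Thm. 7.4,
`KuriharaRoad.plusEtaLowerInclusionAt_of_etaEisensteinFrame`); not a Literature FACT (no `_holds` is
possible or wanted while the source is unrefereed).

## References

* F. Castella, T. Sano, arXiv:2601.14504 (2026): §1 (PDF p. 3), §1.1.1–1.1.4 with Conj. 2, Thm. 1,
  Cor. 1 (PDF pp. 3–4), §1.3.1 (PDF p. 6), §2.1 (PDF p. 7), §2.2 Conj. 2.2.2, Prop. 2.2.3, Remark 2.2.4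
  (PDF p. 9), Cor. 2.3.2 (PDF p. 10), §2.4 (PDF pp. 10–11). [CastellaSano2026]
* C.-H. Kim, Amer. J. Math. 148 (2026) 79–129 = arXiv:2203.12159: Conj. 1.10 (PDF p. 8), Thm. 1.11
  (PDF p. 8), §1.5.1 (PDF p. 7), Remark 6.2 (PDF p. 31). [Kim2022StructureSelmer]
* S. Kobayashi, Invent. Math. 152 (2003): §5 (p. 10), Thm. 5.1 iii), Thm. 5.2 and Remark 5.3 i)
  (pp. 9–10), Thm. 6.3 (p. 11), proof of Thm. 7.4 (p. 13). [Kobayashi2003]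
* K. Kato, Astérisque 295 (2004): §12.2, Thm. 12.4, Thm. 12.5, Conj. 12.10 (pp. 220–224). [Kato2004Asterisque]
* B. Mazur, K. Rubin, *Kolyvagin systems*, Mem. AMS 799 (2004), §5.2, Thm. 5.2.12 (Castella–Sano's
  Thm. 2.1.4). [MazurRubin2004]
-/

noncomputable section

open scoped Classical

open CongruenceSubgroup Polynomial WeierstrassCurve Field Literature.NumberTheory.EllipticCurves
  Literature.NumberTheory.EllipticCurves.ModularForms Literature.NumberTheory.GaloisRepresentations
  ZpExtension

namespace Literature.NumberTheory.EllipticCurves.CastellaSano2026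

/-- **OPEN HYPOTHESIS — UNREFEREED PREPRINT (Castella–Sano, arXiv:2601.14504, 2026), Thm. 1 (i) ⟹ (ii)
for the ADDITIVE partner `W = V ⊗ η_{p*}` of a good supersingular `a_p = 0` curve `V`, read on the pinned
objects of Kobayashi's `η`-package as the EISENSTEIN inclusion `Char_Λ(X⁰) ⊆ Char_Λ(𝐇¹/Λz)`.** Source:
"Theorem 1. Let `p > 3` be a prime such that (sur) and (manin) both hold. Then the following are
equivalent: (i) `𝓜_∞(δ) = ord_p(Tam_E)` … (ii) The Iwasawa Main [C] (conj:IMC-det) for `ℚ_∞/ℚ` holds"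
(PDF p. 4; `E/ℚ` non-CM, §1.1.1; (ii) ⟺ Kato's `char_Λ(H¹(ℤ_S,𝕋)/Λz_∞^{(S)}) = char_Λ(H²(ℤ_S,𝕋))`,
Prop. 2.2.3; ANY reduction type at `p`, §1 p. 3 and §1.3.1 p. 6: "the case `ord_p(Tam_E) > 0` … was wide
open"). TRANSCRIBED on the frame of the published companion
`Kim2026.thm111_etaEisensteinInclusion_of_kuriharaNumber_ne_zero` (same binders up to the certificate,
same conclusion): `p` odd, `K₀ = ℚ(μ_p)`, `η` THE quadratic character, `V/ℚ` globally minimal GOOD at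
`p` with `a_p(V) = 0`, newform `f` of `V`, period ratio `ϖ`, cyclotomic `(κ, γ)` matching the variable,
a GLOBALLY MINIMAL partner `W` with `C • W^{(p*)} = V`; Castella–Sano's hypotheses for `E := W` at the
ADDITIVE prime `p` (reading `CS26-1-additive-scope`): `5 ≤ p`; `¬ W.HasCM`; (sur)
`W.HasSurjectiveModNGaloisRep p`; (manin) as a parametrisation datum `D` of `W` with
`¬ p ∣ D.maninConstant` and the period transfer `Ω(W) = u·Ω⁺_{D.f}`, `|u|_p = 1` (reading `KR-period`);
(i) as Kim's Tamagawa-defect identity over the cyclic levels of the `Ω⁺_{D.f}`-normalised collection,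
`kuriharaPartialInfty W p D.f = ord_p(W.tamagawaProduct)` (reading `CS26-1-cyclic-levels`; = the
Summits predicate `X4.KimTamagawaDefectAt W p D.f`); NO hypothesis `p ∤ Tam_W`, NO hypothesis
`W(ℚ_p)[p] = 0`. CONCLUSION: for every pinned `I : Kato2004.IwasawaH1Data W p κ γ` («`H¹_Iw(ℚ, T_pW)`»)
and `FB : W.FineSelmerDualData κ γ` («`Sel₀(ℚ_∞, W[p^∞])^∨`») some package datum `d` (Kobayashi Thm.
5.2/6.2/6.3/7.3 i)/Cor. 7.2 at `η`) has `Module.charIdeal Λ FB.X ≤ Module.charIdeal Λ (I.H ⧸ Λ∙d.z)` —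
the `⊆` half of (ii) read on the package's zeta line (reading `CS26-1-eta-zeta-line` = the companion's
`Kim26-111-eta-zeta-line`; the `⊇` half under the onto tower is the package field `kato_integral`).
Weaker than the preprint's statement, nothing asserted, no `_holds`; NEVER cite this `Prop` as a
theorem (FRESHNESS 2026-08-28: arXiv v1 only); take it as an explicit hypothesis `(hCS : …)`.
[claim: CastellaSano2026, status: under-review]
[cite: Kim2022StructureSelmer, Conj. 1.10 (PDF p. 8), Thm. 1.11 (PDF p. 8), §1.5.1 (PDF p. 7), Remark 6.2 (PDF p. 31)]
[cite: Kobayashi2003, §5 (p. 10), Thm. 5.1 iii), Thm. 5.2 and Remark 5.3 i) (pp. 9–10), Thm. 6.3 (p. 11), proof of Thm. 7.4 (p. 13)]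
[cite: Kato2004Asterisque, §12.2 (p. 220), Thm. 12.4 and Thm. 12.5 (pp. 221–222), §12.10 (p. 224)]
[cite: MazurRubin2004, §5.2, Thm. 5.2.12] -/
def thm1_etaEisensteinInclusion_of_kimTamagawaDefect_OPEN : Prop :=
  ∀ (p : ℕ) [Fact p.Prime] (K₀ : Type) [Field K₀] [NumberField K₀] [IsCyclotomicExtension {p} ℚ K₀]
    [(galRange (K := ℚ) K₀).Normal] (η : absoluteGaloisGroup ℚ →* ℤˣ),
    (∀ σ ∈ galRange (K := ℚ) K₀, η σ = 1) → η ≠ 1 →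
  ∀ (V : WeierstrassCurve ℚ) [V.IsElliptic] [V.IsGloballyMinimal] {N : ℕ} [NeZero N]
    {f : CuspForm (Gamma0 N) 2},
    p ≠ 2 → V.HasGoodReductionAtPrime p → V.frobeniusTrace p = 0 → IsNewformOf V f →
  ∀ (ϖ : ℚ), (if Even (p / 2) then (ϖ : ℝ) * V.realPeriodRat = plusPeriod f
      else (ϖ : ℝ) * V.imaginaryPeriodRat = minusPeriod f) →
  ∀ (κ : ZpExtension ℚ p) (γ : absoluteGaloisGroup ℚ),
    κ.IsCyclotomic → κ.IsTopGenerator γ → γ ∈ galRange (K := ℚ) K₀ → IsCyclotomicVariable p γ →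
  ∀ (W : WeierstrassCurve ℚ) [W.IsElliptic] [W.IsGloballyMinimal]
    [ContinuousSMul ℤ_[p] (W.tateModule p)]
    (C : VariableChange ℚ), C • W.quadraticTwist ((-1) ^ (p / 2) * p) = V →
  -- Castella–Sano's standing hypotheses for `E := W` at `p`: `p > 3`, non-CM, (sur)
    5 ≤ p → ¬ W.HasCM → W.HasSurjectiveModNGaloisRep p →
  -- (manin), as a parametrisation datum with `p ∤ c` and the `p`-unit period transfer
  ∀ {NW : ℕ} [NeZero NW] (D : ModularParametrizationData W NW),
    ¬ (p : ℤ) ∣ D.maninConstant →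
    (∃ u : ℚ, ‖(u : ℚ_[p])‖ = 1 ∧ W.realPeriodRat = u * plusPeriod D.f) →
  -- (i): Kim's Tamagawa-defect identity `∂^{(∞)}(δ̃(W)) = ord_p Tam_W` (cyclic levels)
    kuriharaPartialInfty W p D.f = (padicValNat p W.tamagawaProduct : ℕ∞) →
  -- (ii), its Eisenstein half, read on the pinned objects of the `η`-package
  ∀ (I : Kato2004.IwasawaH1Data W p κ γ) (FB : W.FineSelmerDualData κ γ),
    ∃ d : Kobayashi2003.EtaKatoColemanPoitouTateData p K₀ η V f ϖ κ γ W I FB,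
      Module.charIdeal (IwasawaAlgebra p) FB.X ≤
        Module.charIdeal (IwasawaAlgebra p) (I.H ⧸ Submodule.span (IwasawaAlgebra p) {d.z})

end Literature.NumberTheory.EllipticCurves.CastellaSano2026

end
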